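import Literature.NumberTheory.ModularForms.EtaQuotientModularForms
import Mathlib.NumberTheory.ModularForms.Derivative
import HarnessLib

/-!
# Logarithmic derivatives of `η`-quotients in terms of `E₂`, and the level-6 forms `Z`, `t`

Third file of the level-6 story (`EtaQuotientModularForms.lean`: `Z = η(τ)⁴η(3τ)⁴/(η(2τ)²η(6τ)²)`,
`t = (η(2τ)η(6τ)/(η(τ)η(3τ)))⁶`; `DombEtaQuotientCM*.lean`: their values at `τ₀`). From Mathlib's
`ModularForm.logDeriv_eta_eq_E2` (`η′/η = (πi/12) E₂`, `EisensteinSeries.E2`) and the chain rule: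

* `logDeriv_eta_natMul` — `(d/dz) log η(δz) = δ (πi/12) E₂(δz)`;
* `logDeriv_etaQuotientC` — **`(d/dz) log ∏_{δ∣N} η(δz)^{r_δ} = (πi/12) Σ_δ r_δ δ E₂(δz)`**;
* `deriv_etaQuotientC` — the same as `f′ = (πi/12)(Σ r_δ δ E₂(δz)) f`;
* level `6`: `logDeriv_dombZ` — `Z′/Z = (πi/3)(E₂(z) − E₂(2z) + 3E₂(3z) − 3E₂(6z))`, i.e.
  `DZ = (1/6)(E₂(τ) − E₂(2τ) + 3E₂(3τ) − 3E₂(6τ)) Z` for `D = (2πi)⁻¹ d/dτ`; and `logDeriv_dombT` —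
  `t′/t = (πi/2)(−E₂(z) + 2E₂(2z) − 3E₂(3z) + 6E₂(6z))`, i.e.
  `Dt/t = (1/4)(−E₂(τ) + 2E₂(2τ) − 3E₂(3τ) + 6E₂(6τ))` — the weight-2 level-6 forms `DZ/Z − E₂/6`
  (Serre derivative) and `Dt/t` through which the Picard–Fuchs equation of the Domb series
  (`Literature.Analysis.ODE.dombSeries_picardFuchs`) is to be pulled back to `ℍ` (Zagier, *Elliptic
  modular forms and their applications*, Prop. 21; [BorweinEtAl2012, §4 Remark 7]).

Everything is proved; no facts.

## References

* D. Zagier, *Elliptic modular forms and their applications* (1-2-3 of Modular Forms, 2008), §5.4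
  Prop. 21 and §2.3 (`η′/η`, `E₂`).
* [BorweinEtAl2012] J. M. Borwein, A. Straub, J. Wan, W. Zudilin, *Densities of short uniform random
  walks*, Canad. J. Math. 64 (2012), §4 Remark 7.
-/

noncomputable section

open UpperHalfPlane hiding I
open Complex Filter Topology Finset EisensteinSeries
open scoped Real MatrixGroups ModularForm Manifold

open Literature.NumberTheory.EllipticCurves.ModularForms

namespace Literature.NumberTheory.ModularForms

/-! ### `(log η(δz))′ = δ (πi/12) E₂(δz)` -/

/-- **`(d/dz) log η(δz) = δ · (πi/12) · E₂(δz)`** for `δ ≥ 1` and `Im z > 0`.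
[cite: Zagier2008, §2.3] -/
theorem logDeriv_eta_natMul {δ : ℕ} (hδ : 0 < δ) (τ : ℍ) :
    logDeriv (fun z : ℂ => η ((δ : ℂ) * z)) (τ : ℂ) =
      (δ : ℂ) * ((π * I / 12) * E2 (natMulPt δ hδ τ)) := by
  have hpt : ((δ : ℂ) * (τ : ℂ)) = ((natMulPt δ hδ τ : ℍ) : ℂ) := (coe_natMulPt δ hδ τ).symm
  have hdiff : DifferentiableAt ℂ η ((δ : ℂ) * (τ : ℂ)) := by
    rw [hpt]
    exact ModularForm.differentiableAt_eta_of_mem_upperHalfPlaneSet (natMulPt δ hδ τ).2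
  rw [show (fun z : ℂ => η ((δ : ℂ) * z)) = η ∘ (fun z : ℂ => (δ : ℂ) * z) from rfl,
    logDeriv_comp hdiff (by fun_prop)]
  rw [show deriv (fun z : ℂ => (δ : ℂ) * z) (τ : ℂ) = δ by
    rw [deriv_const_mul _ differentiableAt_id, deriv_id'', mul_one]]
  rw [hpt, ModularForm.logDeriv_eta_eq_E2]
  ring

/-- Differentiability of `z ↦ η(δz)` at points of `ℍ`. [folklore] -/
theorem differentiableAt_eta_natMul {δ : ℕ} (hδ : 0 < δ) (τ : ℍ) :
    DifferentiableAt ℂ (fun z : ℂ => η ((δ : ℂ) * z)) (τ : ℂ) := by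
  have hpt : ((δ : ℂ) * (τ : ℂ)) = ((natMulPt δ hδ τ : ℍ) : ℂ) := (coe_natMulPt δ hδ τ).symm
  have hdiff : DifferentiableAt ℂ η ((δ : ℂ) * (τ : ℂ)) := by
    rw [hpt]
    exact ModularForm.differentiableAt_eta_of_mem_upperHalfPlaneSet (natMulPt δ hδ τ).2
  exact hdiff.comp (τ : ℂ) (by fun_prop)

/-! ### `η`-quotients -/

/-- **`(d/dz) log ∏_{δ∣N} η(δz)^{r_δ} = (πi/12) Σ_{δ∣N} r_δ δ E₂(δz)`.** [cite: Zagier2008, §2.3] -/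
theorem logDeriv_etaQuotientC (N : ℕ) (r : ℕ → ℤ) (τ : ℍ) :
    logDeriv (etaQuotientC N r) (τ : ℂ) =
      (π * I / 12) * ∑ δ ∈ N.divisors.attach,
        (r δ : ℂ) * (δ : ℂ) * E2 (natMulPt δ.1 (Nat.pos_of_mem_divisors δ.2) τ) := by
  have hfun : etaQuotientC N r = fun z => ∏ δ ∈ N.divisors, (fun (δ : ℕ) (z : ℂ) => η ((δ : ℂ) * z) ^ r δ) δ z := by
    funext z; rfl
  rw [hfun, logDeriv_prod]
  · rw [Finset.mul_sum, ← Finset.sum_attach]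
    refine Finset.sum_congr rfl fun δ _ => ?_
    have hδ := Nat.pos_of_mem_divisors δ.2
    rw [show (fun z : ℂ => η ((δ.1 : ℂ) * z) ^ r δ.1) = fun z => (fun w => η ((δ.1 : ℂ) * w)) z ^ r δ.1
      from rfl, logDeriv_fun_zpow (differentiableAt_eta_natMul hδ τ), logDeriv_eta_natMul hδ τ]
    ring
  · intro δ hδ
    exact zpow_ne_zero _ (eta_natMul_ne_zero (Nat.pos_of_mem_divisors hδ) τ.2)
  · intro δ hδ
    exact (differentiableAt_eta_natMul (Nat.pos_of_mem_divisors hδ) τ).zpow (Or.inl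
      (eta_natMul_ne_zero (Nat.pos_of_mem_divisors hδ) τ.2))

/-- Differentiability of the `η`-quotient (as a function on `ℂ`) at points of `ℍ`. [folklore] -/
theorem differentiableAt_etaQuotientC (N : ℕ) (r : ℕ → ℤ) (τ : ℍ) :
    DifferentiableAt ℂ (etaQuotientC N r) (τ : ℂ) := by
  have hfun : etaQuotientC N r = fun z => ∏ δ ∈ N.divisors, (fun (δ : ℕ) (z : ℂ) => η ((δ : ℂ) * z) ^ r δ) δ z := by
    funext z; rfl
  rw [hfun]
  exact DifferentiableAt.fun_finsetProd fun δ hδ =>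
    (differentiableAt_eta_natMul (Nat.pos_of_mem_divisors hδ) τ).zpow (Or.inl
      (eta_natMul_ne_zero (Nat.pos_of_mem_divisors hδ) τ.2))

/-- **`f′ = (πi/12)(Σ r_δ δ E₂(δz)) · f`** for `f = ∏ η(δz)^{r_δ}`. [cite: Zagier2008, §2.3] -/
theorem deriv_etaQuotientC (N : ℕ) (r : ℕ → ℤ) (τ : ℍ) :
    deriv (etaQuotientC N r) (τ : ℂ) =
      (π * I / 12) * (∑ δ ∈ N.divisors.attach,
        (r δ : ℂ) * (δ : ℂ) * E2 (natMulPt δ.1 (Nat.pos_of_mem_divisors δ.2) τ)) *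
        etaQuotientC N r τ := by
  have h := logDeriv_etaQuotientC N r τ
  have hne : etaQuotientC N r τ ≠ 0 := etaQuotient_ne_zero N r τ
  rw [logDeriv_apply, div_eq_iff hne] at h
  rw [h]

/-! ### Level `6`: `Z` and `t` -/

/-- The four points `τ, 2τ, 3τ, 6τ`. [folklore] -/
theorem sum_divisors_six_attach (f : ℕ → ℂ) :
    ∑ δ ∈ (6 : ℕ).divisors.attach, f δ.1 = f 1 + f 2 + f 3 + f 6 := by
  rw [Finset.sum_attach ((6 : ℕ).divisors) f, show (6 : ℕ).divisors = {1, 2, 3, 6} by decide]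
  rw [Finset.sum_insert (by decide), Finset.sum_insert (by decide), Finset.sum_insert (by decide),
    Finset.sum_singleton]
  ring

/-- The point `δτ` for `δ = 1, 2, 3, 6` packaged uniformly. [folklore] -/
def sixMulPt (δ : ℕ) (τ : ℍ) : ℍ := if h : 0 < δ then natMulPt δ h τ else τ

/-- `sixMulPt δ τ = natMulPt δ _ τ` for `δ ≥ 1`. [folklore] -/
theorem sixMulPt_of_pos {δ : ℕ} (hδ : 0 < δ) (τ : ℍ) : sixMulPt δ τ = natMulPt δ hδ τ := by
  simp [sixMulPt, hδ]

/-- **`Z′/Z = (πi/3)(E₂(z) − E₂(2z) + 3E₂(3z) − 3E₂(6z))`** for `Z = η(z)⁴η(3z)⁴/(η(2z)²η(6z)²)`,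
i.e. `DZ = (1/6)(E₂(τ) − E₂(2τ) + 3E₂(3τ) − 3E₂(6τ)) Z` with `D = (2πi)⁻¹ d/dτ`.
[cite: BorweinEtAl2012, §4 Remark 7] -/
theorem logDeriv_dombZ (τ : ℍ) :
    logDeriv (etaQuotientC 6 dombExponents) (τ : ℂ) =
      (π * I / 3) * (E2 (sixMulPt 1 τ) - E2 (sixMulPt 2 τ) + 3 * E2 (sixMulPt 3 τ) -
        3 * E2 (sixMulPt 6 τ)) := by
  rw [logDeriv_etaQuotientC]
  have h := sum_divisors_six_attach (fun δ => (dombExponents δ : ℂ) * (δ : ℂ) * E2 (sixMulPt δ τ))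
  have hre : ∀ δ : {x // x ∈ (6 : ℕ).divisors},
      (dombExponents δ : ℂ) * (δ : ℂ) * E2 (natMulPt δ.1 (Nat.pos_of_mem_divisors δ.2) τ) =
        (dombExponents δ : ℂ) * (δ : ℂ) * E2 (sixMulPt δ τ) := fun δ => by
    rw [sixMulPt_of_pos (Nat.pos_of_mem_divisors δ.2)]
  rw [Finset.sum_congr rfl fun δ _ => hre δ, h]
  simp only [dombExponents]
  norm_num
  ring

/-- **`t′/t = (πi/2)(−E₂(z) + 2E₂(2z) − 3E₂(3z) + 6E₂(6z))`** for `t = (η(2z)η(6z)/(η(z)η(3z)))⁶`,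
i.e. `Dt/t = (1/4)(−E₂(τ) + 2E₂(2τ) − 3E₂(3τ) + 6E₂(6τ))`. [cite: BorweinEtAl2012, §4 Remark 7] -/
theorem logDeriv_dombT (τ : ℍ) :
    logDeriv (etaQuotientC 6 dombHauptmodulExponents) (τ : ℂ) =
      (π * I / 2) * (-E2 (sixMulPt 1 τ) + 2 * E2 (sixMulPt 2 τ) - 3 * E2 (sixMulPt 3 τ) +
        6 * E2 (sixMulPt 6 τ)) := by
  rw [logDeriv_etaQuotientC]
  have h := sum_divisors_six_attach
    (fun δ => (dombHauptmodulExponents δ : ℂ) * (δ : ℂ) * E2 (sixMulPt δ τ))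
  have hre : ∀ δ : {x // x ∈ (6 : ℕ).divisors},
      (dombHauptmodulExponents δ : ℂ) * (δ : ℂ) * E2 (natMulPt δ.1 (Nat.pos_of_mem_divisors δ.2) τ) =
        (dombHauptmodulExponents δ : ℂ) * (δ : ℂ) * E2 (sixMulPt δ τ) := fun δ => by
    rw [sixMulPt_of_pos (Nat.pos_of_mem_divisors δ.2)]
  rw [Finset.sum_congr rfl fun δ _ => hre δ, h]
  simp only [dombHauptmodulExponents]
  norm_num
  ring

end Literature.NumberTheory.ModularForms

end
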